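import Literature.Computability.Complexity.CodeFPListKit
import Literature.Computability.Complexity.CodeFPArith
import Literature.Computability.Complexity.CodeFPBudgets
import Literature.Computability.Complexity.CodeFPStringKit
import Literature.Computability.Complexity.CodeFPTableKit
import Summits.PneNP.PneNP.Theorems.SfmBlMachinePieces
import Summits.QuantumFields.BalabanUV.T4Continuum.Support.SpaceTimeAnimals

/-!
# Line «sfm-bl», MACHINE LAYER M2a: the piece graph and the enumeration of walks (stmt-PneNP-20523)

FRONTIER F-N1c; nothing here bears on P vs NP.

MACHINE-PLAN stage M2 needs, inside the spot-extraction loop and for sparseness, ALL connected pairs of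
the piece graph of total size `≤ t₀`.  This file enumerates them as SUPPORTS OF WALKS: the vertex lists
of all walks of length `ℓ` of the piece multigraph (one edge per leg between its left piece `labL` and its
right piece `labR`, labels `(side, vertex, block) : ℕ × ℕ × ℕ` read off the pieced legs of M1
`SfmBlMachine.pieceLegs`).  Completeness is the tree's closed-walk encoding
(`Summit.QuantumFields.BalabanUV.T4Continuum.SpaceTimePeierls.exists_covering_walk`: a connected `S` is the
support of a closed walk of length `2(#S − 1)`), so no canonical-set machinery is needed:
`exists_mem_walksU_of_connected`.  The enumeration is a fold of «extend every walk by every leg at its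
endpoint» with a CAP on the number of walks kept (`walksC`, cap in unary in the context — this makes the
accumulator of `CodeFP.foldl` polynomially bounded on every input; `walksC_eq_walksU` says the cap is
invisible when it exceeds the true counts, which are `≤ #pieces · D^ℓ` for `D` legs per piece,
`length_walksU_le`).  Typing: `codeFP_walksC`.
-/

set_option linter.dupNamespace false -- `Summit.PneNP.PneNP.…`: summit = sub-problem name (D-0017 single-conjunct layout)

namespace Summit.PneNP.PneNP.Theorems.SfmBlMachine

open Literature.Computability.Complexity CodeFP

/-! ## Piece labels, neighbours, walks (plain list functions) -/

/-- A piece label `(side, vertex, block)`: side `0` = left (heads), `1` = right (data / constant column). -/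
abbrev Lab := ℕ × ℕ × ℕ

/-- A pieced leg `(j, t, c, bL, v, bR)` (the items of `pieceLegs`). -/
abbrev PLeg := ℕ × ℕ × ℕ × ℕ × ℕ × ℕ

/-- Left piece of a pieced leg: `(0, c, bL)`. -/
def labL (x : PLeg) : Lab := (0, x.2.2.1, x.2.2.2.1)

/-- Right piece of a pieced leg: `(1, v, bR)`. -/
def labR (x : PLeg) : Lab := (1, x.2.2.2.2.1, x.2.2.2.2.2)

/-- A left piece is never a right piece. -/
theorem labL_ne_labR (x y : PLeg) : labL x ≠ labR y := by
  simp [labL, labR]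

/-- The pieces (deduplicated labels of all leg endpoints). -/
def pieces (plegs : List PLeg) : List Lab := (plegs.map labL ++ plegs.map labR).dedup

/-- Neighbours of a piece along the legs (with multiplicity: one entry per leg). -/
def nbrs (plegs : List PLeg) (P : Lab) : List Lab :=
  ((plegs.filter fun x => labL x = P).map labR) ++ ((plegs.filter fun x => labR x = P).map labL)

/-- A WALK record: (endpoint, vertex list from the start to the endpoint). -/
abbrev WalkRec := Lab × List Lab

/-- Extend every walk by every leg at its endpoint. -/
def extend (plegs : List PLeg) (ws : List WalkRec) : List WalkRec :=
  (ws.map fun w => (nbrs plegs w.1).map fun Q => (Q, w.2 ++ [Q])).flatten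

/-- The trivial walks (one per piece). -/
def walks0 (plegs : List PLeg) : List WalkRec := (pieces plegs).map fun P => (P, [P])

/-- All walks of length `ℓ` (uncapped; the SPEC). -/
def walksU (plegs : List PLeg) : ℕ → List WalkRec
  | 0 => walks0 plegs
  | ℓ + 1 => extend plegs (walksU plegs ℓ)

/-- The capped enumeration the machine runs: `|u|` rounds of «extend, keep the first `cap`». -/
def walksC (plegs : List PLeg) (cap : ℕ) (u : List Unit) : List WalkRec :=
  u.foldl (fun ws _ => (extend plegs ws).take cap) (walks0 plegs)

/-! ## The cap is invisible below the true counts -/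

/-- `walksC` from an arbitrary start. -/
theorem foldl_extend_take_eq (plegs : List PLeg) (cap : ℕ) :
    ∀ (u : List Unit) (ws : List WalkRec),
      (∀ k, k ≤ u.length → (Nat.iterate (extend plegs) k ws).length ≤ cap) →
      u.foldl (fun ws _ => (extend plegs ws).take cap) ws = Nat.iterate (extend plegs) u.length ws := by
  intro u
  induction u with
  | nil => intro ws _; rfl
  | cons _ u ih =>
    intro ws hcap
    rw [List.foldl_cons, List.length_cons, Function.iterate_succ_apply]
    have h1 : (extend plegs ws).length ≤ cap := by
      have := hcap 1 (by simp)
      simpa using this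
    rw [List.take_of_length_le h1]
    apply ih
    intro k hk
    have := hcap (k + 1) (by simpa using hk)
    rwa [Function.iterate_succ_apply] at this

/-- The uncapped walks as an iterate. -/
theorem walksU_eq_iterate (plegs : List PLeg) (ℓ : ℕ) :
    walksU plegs ℓ = Nat.iterate (extend plegs) ℓ (walks0 plegs) := by
  induction ℓ with
  | zero => rfl
  | succ ℓ ih => rw [walksU, ih, Function.iterate_succ_apply']

/-- If no true count up to round `|u|` exceeds the cap, the machine's capped enumeration IS the spec. -/
theorem walksC_eq_walksU (plegs : List PLeg) (cap : ℕ) (u : List Unit)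
    (h : ∀ k, k ≤ u.length → (walksU plegs k).length ≤ cap) :
    walksC plegs cap u = walksU plegs u.length := by
  rw [walksU_eq_iterate]
  exact foldl_extend_take_eq plegs cap u (walks0 plegs) fun k hk => by rw [← walksU_eq_iterate]; exact h k hk

/-- Growth: one round multiplies the number of walks by at most the maximal number of legs at a piece. -/
theorem length_extend_le (plegs : List PLeg) (ws : List WalkRec) {D : ℕ} (hD : ∀ P, (nbrs plegs P).length ≤ D) :
    (extend plegs ws).length ≤ ws.length * D := by
  unfold extend
  rw [List.length_flatten, List.map_map]
  have : ∀ w ∈ ws, ((List.length ∘ fun w : WalkRec => (nbrs plegs w.1).map fun Q => (Q, w.2 ++ [Q])) w) ≤ D :=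
    fun w _ => by simpa using hD w.1
  calc (ws.map (List.length ∘ fun w : WalkRec => (nbrs plegs w.1).map fun Q => (Q, w.2 ++ [Q]))).sum
      ≤ (ws.map fun _ => D).sum := List.sum_le_sum (fun w hw => this w hw)
    _ = ws.length * D := by rw [List.map_const', List.sum_replicate, smul_eq_mul]

/-- **Counting**: `#walks of length ℓ ≤ #pieces · D^ℓ`. -/
theorem length_walksU_le (plegs : List PLeg) {D : ℕ} (hD : ∀ P, (nbrs plegs P).length ≤ D) (ℓ : ℕ) :
    (walksU plegs ℓ).length ≤ (pieces plegs).length * D ^ ℓ := by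
  induction ℓ with
  | zero => simp [walksU, walks0]
  | succ ℓ ih =>
    calc (walksU plegs (ℓ + 1)).length ≤ (walksU plegs ℓ).length * D := length_extend_le plegs _ hD
      _ ≤ (pieces plegs).length * D ^ ℓ * D := Nat.mul_le_mul_right _ ih
      _ = (pieces plegs).length * D ^ (ℓ + 1) := by rw [pow_succ, mul_assoc]

/-! ## The piece graph and completeness of the enumeration -/

/-- The PIECE GRAPH (simple graph underlying the leg multigraph): `P ~ Q` iff some leg joins them. -/
def pieceGraph (plegs : List PLeg) : SimpleGraph Lab :=
  SimpleGraph.fromRel fun P Q => Q ∈ nbrs plegs P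

/-- Neighbourhood is symmetric. -/
theorem mem_nbrs_comm (plegs : List PLeg) (P Q : Lab) : Q ∈ nbrs plegs P ↔ P ∈ nbrs plegs Q := by
  unfold nbrs
  simp only [List.mem_append, List.mem_map, List.mem_filter, decide_eq_true_eq]
  constructor
  · rintro (⟨x, ⟨hx, hP⟩, hQ⟩ | ⟨x, ⟨hx, hP⟩, hQ⟩)
    · exact Or.inr ⟨x, ⟨hx, hQ⟩, hP⟩
    · exact Or.inl ⟨x, ⟨hx, hQ⟩, hP⟩
  · rintro (⟨x, ⟨hx, hQ⟩, hP⟩ | ⟨x, ⟨hx, hQ⟩, hP⟩)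
    · exact Or.inr ⟨x, ⟨hx, hP⟩, hQ⟩
    · exact Or.inl ⟨x, ⟨hx, hP⟩, hQ⟩

/-- Adjacency in the piece graph. -/
theorem pieceGraph_adj (plegs : List PLeg) (P Q : Lab) :
    (pieceGraph plegs).Adj P Q ↔ P ≠ Q ∧ Q ∈ nbrs plegs P := by
  unfold pieceGraph
  rw [SimpleGraph.fromRel_adj]
  constructor
  · rintro ⟨hne, h | h⟩
    · exact ⟨hne, h⟩
    · exact ⟨hne, (mem_nbrs_comm plegs Q P).1 h⟩
  · rintro ⟨hne, h⟩
    exact ⟨hne, Or.inl h⟩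

/-- A neighbour of anything is a piece. -/
theorem mem_pieces_of_mem_nbrs (plegs : List PLeg) {P Q : Lab} (h : Q ∈ nbrs plegs P) : Q ∈ pieces plegs := by
  unfold pieces
  rw [List.mem_dedup, List.mem_append, List.mem_map, List.mem_map]
  unfold nbrs at h
  simp only [List.mem_append, List.mem_map, List.mem_filter] at h
  rcases h with ⟨x, ⟨hx, _⟩, rfl⟩ | ⟨x, ⟨hx, _⟩, rfl⟩
  · exact Or.inr ⟨x, hx, rfl⟩
  · exact Or.inl ⟨x, hx, rfl⟩

/-- **Every walk of the piece graph from a piece is enumerated**: its support is the vertex list of a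
record in `walksU` at its length. -/
theorem support_mem_walksU (plegs : List PLeg) {P Q : Lab} (hP : P ∈ pieces plegs)
    (w : (pieceGraph plegs).Walk P Q) : (Q, w.support) ∈ walksU plegs w.length := by
  induction w using SimpleGraph.Walk.concatRec with
  | Hnil =>
    simp only [SimpleGraph.Walk.support_nil, SimpleGraph.Walk.length_nil, walksU, walks0, List.mem_map]
    exact ⟨_, hP, rfl⟩
  | Hconcat p h ih =>
    rename_i R S
    rw [SimpleGraph.Walk.length_concat, walksU, SimpleGraph.Walk.support_concat]
    unfold extend
    rw [List.mem_flatten]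
    refine ⟨(nbrs plegs R).map fun Q => (Q, p.support ++ [Q]), List.mem_map.2 ⟨(R, p.support), ih hP, rfl⟩, ?_⟩
    rw [List.mem_map]
    exact ⟨S, ((pieceGraph_adj plegs R S).1 h).2, rfl⟩

/-- **COMPLETENESS FOR CONNECTED SETS**: every connected vertex set `S` of the piece graph with `s + 1`
elements, all of them pieces, is the support of some enumerated walk of length `2s`. -/
theorem exists_mem_walksU_of_connected (plegs : List PLeg) (S : Finset Lab) (hS : ∀ P ∈ S, P ∈ pieces plegs)
    {s : ℕ} (hcard : S.card = s + 1) (hconn : ((pieceGraph plegs).induce (S : Set Lab)).Connected) :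
    ∃ w ∈ walksU plegs (2 * s), w.2.toFinset = S := by
  classical
  obtain ⟨v, hv⟩ : S.Nonempty := Finset.card_pos.1 (by rw [hcard]; exact Nat.succ_pos s)
  obtain ⟨p, hlen, hsupp⟩ :=
    Summit.QuantumFields.BalabanUV.T4Continuum.SpaceTimePeierls.exists_covering_walk (pieceGraph plegs)
      (s + 1) S hcard hconn hv
  have hl : p.length = 2 * s := by omega
  exact ⟨(v, p.support), hl ▸ support_mem_walksU plegs (hS v hv) p, hsupp⟩

/-! ## Typing in the `CodeFP` algebra -/

section PolyTime

open Polynomial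

/-- Code of a piece label. -/
abbrev labE : Lab → List Bool := pairE natE (pairE natE natE)

/-- Code of a walk record. -/
abbrev walkE : WalkRec → List Bool := pairE labE (rawE labE)

/-- `labE` is injective. -/
theorem labE_injective : Function.Injective labE :=
  pairE_injective natE_injective (pairE_injective natE_injective natE_injective)

/-- `labL` is polynomial time. -/
theorem codeFP_labL : CodeFP plegE labE labL :=
  ((const plegE (0 : ℕ)).pair ((snd _ _).snd'.fst'.pair (snd _ _).snd'.snd'.fst')).congr fun _ => rfl

/-- `labR` is polynomial time. -/
theorem codeFP_labR : CodeFP plegE labE labR :=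
  ((const plegE (1 : ℕ)).pair ((snd _ _).snd'.snd'.snd'.fst'.pair (snd _ _).snd'.snd'.snd'.snd')).congr
    fun _ => rfl

/-- `pieces` is polynomial time. -/
theorem codeFP_pieces : CodeFP (rawE plegE) (rawE labE) pieces :=
  ((dedup labE labE_injective).comp ((rawAppend labE).comp ((map₀ codeFP_labL).pair (map₀ codeFP_labR)))).congr
    fun _ => rfl

/-- `nbrs` is polynomial time. -/
theorem codeFP_nbrs : CodeFP (pairE (rawE plegE) labE) (rawE labE) (fun p => nbrs p.1 p.2) := by
  have hL : CodeFP (pairE labE plegE) bitE (fun t => decide (labL t.2 = t.1)) :=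
    ((CodeFP.eq labE_injective).comp ((codeFP_labL.comp (snd _ _)).pair (fst _ _))).congr fun _ => rfl
  have hR : CodeFP (pairE labE plegE) bitE (fun t => decide (labR t.2 = t.1)) :=
    ((CodeFP.eq labE_injective).comp ((codeFP_labR.comp (snd _ _)).pair (fst _ _))).congr fun _ => rfl
  have hswap : CodeFP (pairE (rawE plegE) labE) (pairE labE (rawE plegE)) (fun p => (p.2, p.1)) :=
    (snd _ _).pair (fst _ _)
  have h1 : CodeFP (pairE (rawE plegE) labE) (rawE labE)
      (fun p => (p.1.filter fun x => decide (labL x = p.2)).map labR) :=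
    ((map₀ codeFP_labR).comp ((filter hL).comp hswap)).congr fun _ => rfl
  have h2 : CodeFP (pairE (rawE plegE) labE) (rawE labE)
      (fun p => (p.1.filter fun x => decide (labR x = p.2)).map labL) :=
    ((map₀ codeFP_labL).comp ((filter hR).comp hswap)).congr fun _ => rfl
  exact ((rawAppend labE).comp (h1.pair h2)).congr fun _ => rfl

/-- `extend` is polynomial time. -/
theorem codeFP_extend : CodeFP (pairE (rawE plegE) (rawE walkE)) (rawE walkE) (fun p => extend p.1 p.2) := by
  have g1 : CodeFP (pairE walkE labE) walkE (fun t => (t.2, t.1.2 ++ [t.2])) :=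
    (snd _ _).pair ((rawAppend labE).comp ((fst _ _).snd'.pair ((rawSingleton labE).comp (snd _ _))))
  have g2 : CodeFP (pairE (rawE plegE) walkE) (rawE walkE)
      (fun t => (nbrs t.1 t.2.1).map fun Q => (Q, t.2.2 ++ [Q])) :=
    ((map g1).comp ((snd _ _).pair (codeFP_nbrs.comp ((fst _ _).pair (snd _ _).fst')))).congr fun _ => rfl
  exact ((flatten walkE).comp (map g2)).congr fun _ => rfl

/-- `walks0` is polynomial time. -/
theorem codeFP_walks0 : CodeFP (rawE plegE) (rawE walkE) walks0 :=
  ((map₀ ((CodeFP.id labE).pair (rawSingleton labE))).comp codeFP_pieces).congr fun _ => rfl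

/-! ### The capped walk fold: invariants and the accumulator bound -/

/-- Invariant of the walk fold after `r` rounds: endpoints and visited labels are pieces, and the visited
list has at most `r + 1` entries. -/
def WalkInv (plegs : List PLeg) (r : ℕ) (ws : List WalkRec) : Prop :=
  ∀ w ∈ ws, w.1 ∈ pieces plegs ∧ (∀ Q ∈ w.2, Q ∈ pieces plegs) ∧ w.2.length ≤ r + 1

/-- The trivial walks satisfy the invariant. -/
theorem walkInv_walks0 (plegs : List PLeg) : WalkInv plegs 0 (walks0 plegs) := by
  intro w hw
  unfold walks0 at hw
  obtain ⟨P, hP, rfl⟩ := List.mem_map.1 hw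
  refine ⟨hP, fun Q hQ => ?_, by simp⟩
  rw [List.mem_singleton] at hQ
  rw [hQ]; exact hP

/-- One capped round preserves the invariant. -/
theorem walkInv_step (plegs : List PLeg) (cap r : ℕ) {ws : List WalkRec} (h : WalkInv plegs r ws) :
    WalkInv plegs (r + 1) ((extend plegs ws).take cap) := by
  intro w hw
  have hw' : w ∈ extend plegs ws := List.mem_of_mem_take hw
  unfold extend at hw'
  rw [List.mem_flatten] at hw'
  obtain ⟨l, hl, hwl⟩ := hw'
  obtain ⟨w₀, hw₀, rfl⟩ := List.mem_map.1 hl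
  obtain ⟨Q, hQ, rfl⟩ := List.mem_map.1 hwl
  obtain ⟨_, hvis, hlen⟩ := h w₀ hw₀
  refine ⟨mem_pieces_of_mem_nbrs plegs hQ, fun Q' hQ' => ?_, ?_⟩
  · rw [List.mem_append, List.mem_singleton] at hQ'
    rcases hQ' with hQ' | rfl
    · exact hvis Q' hQ'
    · exact mem_pieces_of_mem_nbrs plegs hQ
  · rw [List.length_append, List.length_singleton]; omega

/-- The fold state after a budget `u`: invariant with `r = |u|` and at most `max #pieces cap` walks. -/
theorem walkInv_foldl (plegs : List PLeg) (cap : ℕ) :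
    ∀ (u : List Unit) (r : ℕ) (ws : List WalkRec), WalkInv plegs r ws → ws.length ≤ max (pieces plegs).length cap →
      WalkInv plegs (r + u.length) (u.foldl (fun ws _ => (extend plegs ws).take cap) ws) ∧
      (u.foldl (fun ws _ => (extend plegs ws).take cap) ws).length ≤ max (pieces plegs).length cap := by
  intro u
  induction u with
  | nil => intro r ws h hl; exact ⟨by simpa using h, hl⟩
  | cons _ u ih =>
    intro r ws h _
    rw [List.foldl_cons, List.length_cons, show r + (u.length + 1) = (r + 1) + u.length by omega]
    exact ih (r + 1) _ (walkInv_step plegs cap r h)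
      ((List.length_take_le _ _).trans (le_max_right _ _))

/-- Code length of a piece label is controlled by the code of the pieced legs. -/
theorem length_labE_le_of_mem_pieces (plegs : List PLeg) {Q : Lab} (hQ : Q ∈ pieces plegs) :
    (labE Q).length ≤ (rawE plegE plegs).length + 4 := by
  unfold pieces at hQ
  rw [List.mem_dedup, List.mem_append, List.mem_map, List.mem_map] at hQ
  have h0 : (natE 0).length = 0 := rfl
  have h1 : (natE 1).length = 1 := rfl
  rcases hQ with ⟨x, hx, rfl⟩ | ⟨x, hx, rfl⟩
  · have hx' := length_item_le_length_rawE plegE hx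
    obtain ⟨j, t, c, bL, v, bR⟩ := x
    simp only [labL, plegE, pairE_apply, length_boolPair] at hx' ⊢
    rw [h0]; omega
  · have hx' := length_item_le_length_rawE plegE hx
    obtain ⟨j, t, c, bL, v, bR⟩ := x
    simp only [labR, plegE, pairE_apply, length_boolPair] at hx' ⊢
    rw [h1]; omega

/-- Code length of a walk record under the invariant. -/
theorem length_walkE_le (plegs : List PLeg) {r : ℕ} {w : WalkRec}
    (h : w.1 ∈ pieces plegs ∧ (∀ Q ∈ w.2, Q ∈ pieces plegs) ∧ w.2.length ≤ r + 1) :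
    (walkE w).length ≤ (2 * ((rawE plegE plegs).length + 4) + 2) * (r + 2) := by
  obtain ⟨h1, h2, h3⟩ := h
  set B := (rawE plegE plegs).length + 4 with hB
  have hQ := length_labE_le_of_mem_pieces plegs h1
  have hvis : (rawE labE w.2).length ≤ w.2.length * (2 * B + 2) :=
    length_rawE_le_of_forall fun Q hQ' => length_labE_le_of_mem_pieces plegs (h2 Q hQ')
  have hvis' : (rawE labE w.2).length ≤ (r + 1) * (2 * B + 2) := hvis.trans (Nat.mul_le_mul_right _ h3)
  obtain ⟨Q, vis⟩ := w
  simp only [walkE, pairE_apply, length_boolPair] at hQ hvis' ⊢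
  nlinarith

/-- **The capped walk enumeration is polynomial time** (context `(pieced legs, cap)` with the cap in
UNARY, budget = the rounds as units). -/
theorem codeFP_walksC :
    CodeFP (pairE (pairE (rawE plegE) unE) (rawE unitE)) (rawE walkE) (fun p => walksC p.1.1 p.1.2 p.2) := by
  have hstep : CodeFP (pairE (pairE (rawE plegE) unE) (pairE unitE (rawE walkE))) (rawE walkE)
      (fun t => (extend t.1.1 t.2.2).take t.1.2) :=
    ((rawTakeUn walkE).comp ((fst _ _).snd'.pair (codeFP_extend.comp ((fst _ _).fst'.pair (snd _ _).snd')))).congr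
      fun _ => rfl
  have hinit : CodeFP (pairE (rawE plegE) unE) (rawE walkE) (fun s => walks0 s.1) :=
    codeFP_walks0.comp (fst _ _)
  have h := foldl (σ := List PLeg × ℕ) (α := Unit) (β := List WalkRec)
    (eσ := pairE (rawE plegE) unE) (eα := unitE) (eβ := rawE walkE)
    (step := fun s _ ws => (extend s.1 ws).take s.2) (init := fun s => walks0 s.1) hstep hinit
    (2 * X * (2 * ((2 * (X + 4) + 2) * (X + 2)) + 2)) (fun s l₁ l₂ => by
      obtain ⟨plegs, cap⟩ := s
      set n := (pairE (pairE (rawE plegE) unE) (rawE unitE) ((plegs, cap), l₁ ++ l₂)).length with hn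
      -- sizes of the parts
      have hP : (rawE plegE plegs).length ≤ n := by
        rw [hn]; simp only [pairE_apply, length_boolPair]; omega
      have hcap : cap ≤ n := by
        rw [hn]; simp only [pairE_apply, length_boolPair, length_unE]; omega
      have hl₁ : l₁.length ≤ n := by
        have := length_le_length_rawE unitE (l₁ ++ l₂)
        rw [List.length_append] at this
        rw [hn]; simp only [pairE_apply, length_boolPair]; omega
      have hpieces : (pieces plegs).length ≤ 2 * n := by
        unfold pieces
        have := (List.dedup_sublist (plegs.map labL ++ plegs.map labR)).length_le
        rw [List.length_append, List.length_map, List.length_map] at this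
        have := length_le_length_rawE plegE plegs
        omega
      -- the state
      obtain ⟨hinv, hlen⟩ := walkInv_foldl plegs cap l₁ 0 (walks0 plegs) (walkInv_walks0 plegs)
        (by unfold walks0; rw [List.length_map]; exact le_max_left _ _)
      rw [Nat.zero_add] at hinv
      have hcount : (l₁.foldl (fun ws _ => (extend plegs ws).take cap) (walks0 plegs)).length ≤ 2 * n :=
        hlen.trans (max_le hpieces (hcap.trans (by omega)))
      have hitem : ∀ w ∈ l₁.foldl (fun ws _ => (extend plegs ws).take cap) (walks0 plegs),
          (walkE w).length ≤ (2 * (n + 4) + 2) * (n + 2) := by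
        intro w hw
        refine (length_walkE_le plegs (hinv w hw)).trans ?_
        exact Nat.mul_le_mul (by omega) (by omega)
      have hstate := length_rawE_le_of_forall hitem
      have heval : (2 * X * (2 * ((2 * (X + 4) + 2) * (X + 2)) + 2) : Polynomial ℕ).eval n
          = 2 * n * (2 * ((2 * (n + 4) + 2) * (n + 2)) + 2) := by
        simp
      show (rawE walkE (l₁.foldl (fun ws _ => (extend plegs ws).take cap) (walks0 plegs))).length ≤ _
      rw [heval]
      exact hstate.trans (Nat.mul_le_mul_right _ hcount))
  exact h.congr fun p => rfl

end PolyTime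

end Summit.PneNP.PneNP.Theorems.SfmBlMachine
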